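import Summits.BirchSwinnertonDyer.BirchSwinnertonDyer.Theorems.PrintCf2DisegniPairTwoQuotientLawChi8
import Literature.NumberTheory.EllipticCurves.PAdicLFunctionZeroAtMinusTwoProofs
import Literature.NumberTheory.EllipticCurves.PAdicBSDMemIwasawaRatProofs
import Literature.NumberTheory.EllipticCurves.PAdicLFunctionNeZeroHoldsProofs
import Literature.NumberTheory.EllipticCurves.KatoTwistedFinitenessQuadraticTwistProofs
import Literature.NumberTheory.EllipticCurves.KatoTwistedFinitenessQuadraticTwistEvenProofs
import HarnessLib

/-!
# Road (C) `disegni-pair-two` on crux stmt-BirchSwinnertonDyer-20368 — the COMPANION CANCELS: the quotient law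
# on the `χ₈∘N`-line needs only `L(W′,1) ≠ 0`, not the companion's BSD formula

Cell `bsd-print-cf2` (`run/shared/lean/pub/bsd-print-cf2/`), width seat `bsd-line-cf2-p1-w8` g22; sequel of
`PrintCf2DisegniPairTwoQuotientLawChi8.lean`. `--supports stmt-BirchSwinnertonDyer-20368` (helper). THEOREMS ONLY
(no `def`, no named fact, no `sorry`); conditional on every displayed hypothesis. BSD is not proved by any of this;
no summit statement is claimed; 20368 is not closed here.

## What is proved

In `quotient_law_chi8` the companion `W′` (newform `f′⊗χ₈`) enters twice: through `L(W′, 1)` on the archimedean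
side and through the Mazur–Tate–Teitelbaum VALUE `L₂(f′, α, T = −2) = Σ_k [T^k]L₂(f′)(−2)^k` on the `2`-adic side.
By MTT interpolation at `χ₈` (tree `hasSum_coeff_padicLFunction_two_neg_two`: the value is `α⁻³·S₈(f′)`,
`S₈(f′) = Σ_{a mod 8} χ₈(a)[a/8]⁺_{f′}` RATIONAL) and Birch's formula (tree `ratTwistedSymbolSum_mul_plusPeriod_holds`:
`S₈(f′)·Ω⁺_{f′} = τ(χ₈)·L(W′, 1)`), the two occurrences CANCEL:

* `algebraMap_tsum_coeff_padicLFunction_neg_two` — `ι₂(Σ_k [T^k]L₂(f,α)(−2)^k) = ι₂(α⁻³)·S₈(f)` in `ℂ₂`;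
* `ratTwistedSymbolSum_chi8_mul_plusPeriod_eq` — `S₈(f)·Ω⁺_f = τ(χ₈)·W′.entireLFunction 1` for any `W′/ℚ` with
  `a_n(W′) = χ₈(n)·a_n(f)`;
* ★★ `quotient_law_chi8_companion_free` — under the hypotheses of `quotient_law_chi8`:
  `ι⁻¹(L′(W,1)·Z°)·h₂ = −σ₀·log₂5·ι⁻¹(ĥ(P)·u·Ω⁺_f·τ(χ₈))·ι₂(α⁻³)·L₂′(f,−2)` — NO `L(W′,1)`, NO `Ω⁺_{f′}`, no
  companion BSD (the planned (Δ3) input `bsdTriple_of_hasCM_of_L_one_ne_zero` is NOT needed on this road; only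
  `L(W′,1) ≠ 0`). What remains between this and the class's defect key: `L′(W,1) = shaAn(W)·Ω_W·Reg·Tam/tors²`
  (definition + GZ86 rationality), the ONE period ratio `Ω_W/Ω⁺_{f_V}`, and the (Δ1) law for `L₂′(f,−2)`.

References: B. Mazur, J. Tate, J. Teitelbaum, Invent. Math. 84 (1986) §I.8 (8.6), §I.14 [MazurTateTeitelbaum1986Invent];
D. Disegni, Compos. Math. 153 (2017) Thm. B [Disegni2017]; B. Perrin-Riou, Invent. Math. 89 (1987) §1 [PerrinRiou1987].
-/

set_option autoImplicit false
set_option linter.dupNamespace false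

noncomputable section

open scoped Classical MatrixGroups ModularForm NumberField

open CongruenceSubgroup NumberField IsDedekindDomain WeierstrassCurve WeierstrassCurve.Affine.Point
  Literature.NumberTheory.EllipticCurves Literature.NumberTheory.EllipticCurves.ModularForms
  Literature.NumberTheory.EllipticCurves.Disegni2017 Literature.NumberTheory.GaloisRepresentations
  Summit.BirchSwinnertonDyer.Rank1Residual.AdditivePotMult

namespace Summit.BirchSwinnertonDyer.BirchSwinnertonDyer.Theorems.PrintCf2.DisegniPairTwo

section Companion

/-! ### §1 The MTT value at `T = −2` as a number -/

/-- `‖−2‖₂ < 1`. [folklore] -/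
private theorem norm_neg_two_padic_lt_one : ‖(-2 : ℚ_[2])‖ < 1 := by
  rw [norm_neg, show (2 : ℚ_[2]) = ((2 : ℕ) : ℚ_[2]) by norm_num, Padic.norm_p]
  norm_num

/-- A `ℚ_p`-series with bounded coefficients converges at a point of the open unit disc. [folklore] -/
theorem summable_coeff_mul_pow_of_norm_le {p : ℕ} [Fact p.Prime] {F : PowerSeries ℚ_[p]} {C : ℝ}
    (hF : ∀ k, ‖PowerSeries.coeff k F‖ ≤ C) {a : ℚ_[p]} (ha : ‖a‖ < 1) :
    Summable (fun k : ℕ ↦ PowerSeries.coeff k F * a ^ k) := by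
  refine Summable.of_norm_bounded ((summable_geometric_of_lt_one (norm_nonneg _) ha).mul_left C)
    fun k ↦ ?_
  rw [norm_mul, norm_pow]
  exact mul_le_mul_of_nonneg_right (hF k) (pow_nonneg (norm_nonneg _) _)

/-- **`ι₂(Σ_k [T^k]L₂(f,α)(−2)^k) = ι₂(α⁻³)·S₈(f)`** for `E = W/ℚ` globally minimal good ordinary at `2` with
newform `f` (`α = unitRoot W 2`): the series converges in `ℚ₂` (bounded coefficients, `‖−2‖ < 1`) and its image in
`ℂ₂` is the MTT interpolation value at `χ₈` (`hasSum_coeff_padicLFunction_two_neg_two`).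
[cite: MazurTateTeitelbaum1986Invent, §I.14 Proposition (p. 20)] -/
theorem algebraMap_tsum_coeff_padicLFunction_neg_two {W : WeierstrassCurve ℚ} [W.IsElliptic]
    [W.IsGloballyMinimal] {N : ℕ} [NeZero N] {f : CuspForm (Gamma0 N) 2} (hord : IsOrdinaryAt W 2)
    (hf : IsNewformOf W f) :
    algebraMap ℚ_[2] ℂ_[2] (∑' k : ℕ, PowerSeries.coeff k (padicLFunction f (unitRoot W 2 : ℚ_[2])) *
        (-2) ^ k) =
      algebraMap ℚ_[2] ℂ_[2] ((unitRoot W 2 : ℚ_[2])⁻¹ ^ 3) *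
        ratTwistedSymbolSum f (ZMod.χ₈.ringHomComp (Int.castRingHom ℂ_[2])) := by
  obtain ⟨C, hC⟩ := exists_forall_norm_coeff_padicLFunction_le (f := f) hord hf
  have hS := summable_coeff_mul_pow_of_norm_le hC norm_neg_two_padic_lt_one
  have h1 := hS.hasSum.map (algebraMap ℚ_[2] ℂ_[2]) (continuous_algebraMap ℚ_[2] ℂ_[2])
  have h2 := hasSum_coeff_padicLFunction_two_neg_two hord hf
  have hfun : (fun k : ℕ ↦ algebraMap ℚ_[2] ℂ_[2]
      (PowerSeries.coeff k (padicLFunction f (unitRoot W 2 : ℚ_[2]))) * (-2) ^ k) =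
      (algebraMap ℚ_[2] ℂ_[2]) ∘ (fun k : ℕ ↦ PowerSeries.coeff k (padicLFunction f (unitRoot W 2 : ℚ_[2])) *
        (-2) ^ k) := by
    funext k
    simp only [Function.comp_apply, map_mul, map_pow, map_neg, map_ofNat]
  rw [hfun] at h2
  exact h1.unique h2

/-! ### §2 Birch's formula for the companion: `S₈(f′)·Ω⁺_{f′} = τ(χ₈)·L(W′,1)` -/

/-- **Birch's formula for a curve with newform `f′ ⊗ χ₈`**: `W′/ℚ` with `a_n(W′) = χ₈(n)·a_n(f′)` (so `L(W′,·)` is the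
entire continuation of `L(f′⊗χ₈, ·)`) satisfies `S₈(f′)·Ω⁺_{f′} = τ(χ₈)·W′.entireLFunction 1`
(tree `ratTwistedSymbolSum_mul_plusPeriod_holds`, `χ₈` even primitive quadratic).
[cite: MazurTateTeitelbaum1986Invent, §I.8 (8.6)] -/
theorem ratTwistedSymbolSum_chi8_mul_plusPeriod_eq {N : ℕ} [NeZero N] {f : CuspForm (Gamma0 N) 2}
    (hf : IsNewform0 f) (hQ : coeffField f = ⊥) (W' : WeierstrassCurve ℚ)
    (hco : ∀ n : ℕ, ((W'.LFunction n : ℤ) : ℂ) = (ZMod.χ₈.ringHomComp (Int.castRingHom ℂ)) n * cuspCoeff f n) :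
    ratTwistedSymbolSum f (ZMod.χ₈.ringHomComp (Int.castRingHom ℂ)) * (plusPeriod f : ℂ) =
      gaussSum (ZMod.χ₈.ringHomComp (Int.castRingHom ℂ)) (ZMod.stdAddChar (N := 8)) *
        W'.entireLFunction 1 := by
  set χ := ZMod.χ₈.ringHomComp (Int.castRingHom ℂ) with hχdef
  have hE : W'.HasEntireLFunction :=
    hasEntireLFunction_of_coeff_of_isPrimitive _ f isQuadratic_χ₈_ringHomComp isPrimitive_χ₈_ringHomComp hco
  have hinv : χ⁻¹ = χ := isQuadratic_χ₈_ringHomComp.inv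
  exact ratTwistedSymbolSum_mul_plusPeriod_holds hf hQ (χ := χ) isPrimitive_χ₈_ringHomComp
    χ₈_ringHomComp_neg_one (W'.differentiable_entireLFunction hE) (fun s hs ↦ by
      have hs' : (3 / 2 : ℝ) < s.re := by have : (2 : ℝ) < s.re := hs; linarith
      rw [hinv, W'.entireLFunction_eq_LSeries hE hs', LSeries_eq_twistedLSeries_of_coeff _ f χ hco])

/-- The `χ₈`-twisted symbol sum read in `ℂ₂` through `ι⁻¹` is its `ℂ₂`-valued incarnation (both are casts of the
rational `S₈`). [cite: MazurTateTeitelbaum1986Invent, §I.8 (8.6)] -/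
theorem coe_symm_ratTwistedSymbolSum_chi8 (ι : PadicAlgCl 2 ≃+* ℂ) {N : ℕ} (f : CuspForm (Gamma0 N) 2) :
    ((ι.symm (ratTwistedSymbolSum f (ZMod.χ₈.ringHomComp (Int.castRingHom ℂ))) : PadicAlgCl 2) : ℂ_[2]) =
      ratTwistedSymbolSum f (ZMod.χ₈.ringHomComp (Int.castRingHom ℂ_[2])) := by
  rw [ratTwistedSymbolSum_χ₈_eq_cast f ℂ, ratTwistedSymbolSum_χ₈_eq_cast f ℂ_[2], map_ratCast,
    PadicComplex.coe_eq, map_ratCast]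

/-! ### §3 The companion-free quotient law on the `χ₈∘N`-line -/

variable (ι : PadicAlgCl 2 ≃+* ℂ) (K : Type) [Field K] [NumberField K] [IsGalois ℚ K]

/-- ★★ **THE QUOTIENT LAW on the `χ₈∘N`-line, COMPANION-FREE.** Same frame and hypotheses as `quotient_law_chi8`.
Conclusion: `ι⁻¹(L′(W,1)·Z°)·h₂ = −σ₀·log₂5·ι⁻¹(ĥ(P)·u·Ω⁺_f·τ(χ₈))·ι₂(α⁻³)·L₂′(f,−2)` — the companion's value
`L(W′,1)` (archimedean side) has cancelled against the MTT value `L₂(f′,−2) = α⁻³S₈(f′)` via Birch's formula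
`S₈(f′)Ω⁺_{f′} = τ(χ₈)L(W′,1)`; only `L(W′,1) ≠ 0` was used. [cite: Disegni2017, Theorem B (arXiv v3 PDF p. 8)]
[cite: MazurTateTeitelbaum1986Invent, §I.8 (8.6) and §I.14] [cite: PerrinRiou1987, §1] -/
theorem quotient_law_chi8_companion_free (h2 : Module.finrank ℚ K = 2)
    (hsplit : ((Ideal.span {(2 : ℤ)}).primesOver (𝓞 K)).ncard = 2)
    (𝔭 𝔭' : HeightOneSpectrum (𝓞 K)) (h𝔭 : ((2 : ℕ) : 𝓞 K) ∈ 𝔭.asIdeal)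
    (h𝔭' : ((2 : ℕ) : 𝓞 K) ∈ 𝔭'.asIdeal)
    (κ : DirichletCharacter ℂ (NumberField.discr K).natAbs)
    (hκ : ∀ ℓ : ℕ, ℓ.Prime → ℓ ≠ 2 → κ ℓ = (jacobiSym (NumberField.discr K) ℓ : ℂ))
    (hκ2 : κ 2 = if NumberField.discr K % 8 = 1 then 1
        else if NumberField.discr K % 8 = 5 then -1 else 0)
    (hd : Nat.Coprime 2 (NumberField.discr K).natAbs)
    -- the good pair
    (V V' : WeierstrassCurve ℚ) [V.IsElliptic] [V.IsGloballyMinimal] [V'.IsElliptic] [V'.IsGloballyMinimal]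
    (hordV : IsOrdinaryAt V 2) (hordV' : IsOrdinaryAt V' 2) (hap : V'.frobeniusTrace 2 = V.frobeniusTrace 2)
    {N N' : ℕ} [NeZero N] [NeZero N'] (hN : ¬ 2 ∣ N) {f : CuspForm (Gamma0 N) 2}
    {f' : CuspForm (Gamma0 N') 2} (hfV : IsNewformOf V f) (hfV' : IsNewformOf V' f')
    (hV' : ∀ n : ℕ, cuspCoeff f' n = κ (n : ZMod _) * cuspCoeff f n)
    (h0 : HasSum (fun k : ℕ ↦ PowerSeries.coeff k (padicLFunction f (unitRoot V 2 : ℚ_[2])) *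
      (-2 : ℚ_[2]) ^ k) 0)
    -- the member and its companion (archimedean side)
    (hmod : hasEntireLFunction_rat) {M M' : ℕ} [NeZero M] [NeZero M']
    {g : CuspForm (Gamma0 M) 2} {g' : CuspForm (Gamma0 M') 2}
    (W W' : WeierstrassCurve ℚ) [W.IsElliptic] [W'.IsElliptic]
    (hg : IsNewformOf W g) (hg' : IsNewformOf W' g')
    (hgε : ∀ m : ℕ, cuspCoeff g m = (ZMod.χ₈.ringHomComp (Int.castRingHom ℂ)) m * cuspCoeff f m)
    (hg'ε : ∀ m : ℕ, cuspCoeff g' m = (ZMod.χ₈.ringHomComp (Int.castRingHom ℂ)) m * cuspCoeff f' m)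
    (hW1 : W.entireLFunction 1 = 0) (hL : deriv W.entireLFunction 1 ≠ 0) (hL' : W'.entireLFunction 1 ≠ 0)
    -- the tower frame and the sign character
    {H : Type} [Field H] [NumberField H] [Algebra K H] (hKH : Module.finrank K H = 2) {t : H}
    (htK : t ∉ Set.range (algebraMap K H)) (ht2 : t ^ 2 = algebraMap ℚ H 2)
    (G : Subgroup (H ≃ₐ[ℚ] H)) (χ : G →* ℂˣ) (s : G → ℤ) (hs : ∀ σ, ((χ σ : ℂˣ) : ℂ) = (s σ : ℂ))
    (τ : H ≃ₐ[ℚ] H) (hτG : τ ∈ G) (hsτ : s ⟨τ, hτG⟩ = -1)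
    (hτK : ∀ a : K, τ (algebraMap K H a) = algebraMap K H a) (hτt : τ t = -t)
    {u : K} {e : ℚ} (hu : u ∉ Set.range (algebraMap ℚ K)) (hue : u ^ 2 = algebraMap ℚ K e)
    (c : K ≃ₐ[ℚ] K) (hcu : c u = -u)
    -- the member's Mordell–Weil data
    [(V.quadraticTwist 2).IsElliptic] {P : (V.quadraticTwist 2).toAffine.Point}
    (hgen : ∀ R : (V.quadraticTwist 2).toAffine.Point,
      ∃ (k : ℤ) (T : (V.quadraticTwist 2).toAffine.Point), IsOfFinAddOrder T ∧ R = k • P + T)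
    (htors : ∀ Q : ((V.quadraticTwist 2).quadraticTwist e).toAffine.Point, IsOfFinAddOrder Q)
    -- Disegni's datum: invariance, PIN, and the conjoined clauses (PRINT stub of the road)
    (DH : PAdicHeightDataK V 2 H)
    (hDH : ∀ (σ : G) (a b : (V.baseChange H).toAffine.Point),
      DH.pairing (pointGalHom V H σ.1 a) (pointGalHom V H σ.1 b) = DH.pairing a b)
    {h₂ : ℚ_[2]}
    (hpin : DH.pairing
      (twistPointEquivOver V (not_mem_range_rat_of_not_mem_range htK) ht2
        (QuadraticDescent.incl H (V.quadraticTwist 2) P))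
      (twistPointEquivOver V (not_mem_range_rat_of_not_mem_range htK) ht2
        (QuadraticDescent.incl H (V.quadraticTwist 2) P)) = h₂)
    (hGZ : ChiLineGrossZagierClauses ι K V H f (ι (((unitRoot V 2 : ℚ_[2]) : PadicAlgCl 2)))
      (baseChangeDirichlet K (ZMod.χ₈.ringHomComp (Int.castRingHom ℂ))) 𝔭 𝔭' G χ DH) :
    ∃ σ₀ : ℤˣ,
      ((ι.symm (deriv W.entireLFunction 1 *
          zCirc (p := 2) (ι (((unitRoot V 2 : ℚ_[2]) : PadicAlgCl 2))) N
            (baseChangeDirichlet K (ZMod.χ₈.ringHomComp (Int.castRingHom ℂ))) 𝔭 𝔭') : PadicAlgCl 2) : ℂ_[2]) *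
        algebraMap ℚ_[2] ℂ_[2] h₂ =
      -((σ₀ : ℤ) : ℂ_[2]) * algebraMap ℚ_[2] ℂ_[2] (padicLog 2 (cyclotomicGenerator 2)) *
        ((ι.symm ((canonicalHeight P : ℂ) *
            ((splitLocalConstant 2 : ℂ) * (plusPeriod f : ℂ) *
              gaussSum (ZMod.χ₈.ringHomComp (Int.castRingHom ℂ)) (ZMod.stdAddChar (N := 8)))) :
            PadicAlgCl 2) : ℂ_[2]) *
        (algebraMap ℚ_[2] ℂ_[2] ((unitRoot V 2 : ℚ_[2])⁻¹ ^ 3) *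
          algebraMap ℚ_[2] ℂ_[2] (∑' k : ℕ, PowerSeries.coeff k (padicLFunction f (unitRoot V 2 : ℚ_[2])) *
            (k : ℚ_[2]) * (-2) ^ (k - 1))) := by
  obtain ⟨σ₀, hlaw⟩ := quotient_law_chi8 ι K h2 hsplit 𝔭 𝔭' h𝔭 h𝔭' κ hκ hκ2 hd V V' hordV hordV' hap hN hfV hfV'
    hV' h0 hmod W W' hg hg' hgε hg'ε hW1 hL hL' hKH htK ht2 G χ s hs τ hτG hsτ hτK hτt hu hue c hcu hgen htors
    DH hDH hpin hGZ
  refine ⟨σ₀, ?_⟩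
  -- the ring map `ψ = ι⁻¹ : ℂ → ℂ₂`
  set ψ : ℂ →+* ℂ_[2] := (algebraMap (PadicAlgCl 2) ℂ_[2]).comp ι.symm.toRingHom with hψ_def
  have hψ : ∀ z : ℂ, ((ι.symm z : PadicAlgCl 2) : ℂ_[2]) = ψ z := fun z => rfl
  set ι₂ := algebraMap ℚ_[2] ℂ_[2] with hι₂
  -- the companion value on the 2-adic side: `ι₂(L₂(f′,−2)) = ι₂(α⁻³)·ψ(S₈(f′))`
  have hα' : (unitRoot V' 2 : ℚ_[2]) = (unitRoot V 2 : ℚ_[2]) := by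
    rw [show unitRoot V' 2 = unitRoot V 2 by unfold unitRoot; rw [hap]]
  have hval := algebraMap_tsum_coeff_padicLFunction_neg_two hordV' hfV'
  rw [hα', ← coe_symm_ratTwistedSymbolSum_chi8 ι f', hψ] at hval
  -- Birch for the companion: `S₈(f′)·Ω⁺_{f′} = τ(χ₈)·L(W′,1)`
  have hco : ∀ n : ℕ, ((W'.LFunction n : ℤ) : ℂ) =
      (ZMod.χ₈.ringHomComp (Int.castRingHom ℂ)) n * cuspCoeff f' n := fun n ↦ by
    rw [← hg'.2 n, hg'ε n]
  have hBirch := ratTwistedSymbolSum_chi8_mul_plusPeriod_eq hfV'.1 hfV'.coeffField_eq_bot W' hco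
  -- non-vanishing
  have hτ : gaussSum (ZMod.χ₈.ringHomComp (Int.castRingHom ℂ)) (ZMod.stdAddChar (N := 8)) ≠ 0 :=
    gaussSum_stdAddChar_ne_zero isPrimitive_χ₈_ringHomComp
  have hΩ' : (plusPeriod f' : ℂ) ≠ 0 := by
    exact_mod_cast (IsNewform0.plusPeriod_pos_holds hfV'.1 hfV'.coeffField_eq_bot).ne'
  have hS : ratTwistedSymbolSum f' (ZMod.χ₈.ringHomComp (Int.castRingHom ℂ)) ≠ 0 := by
    intro h0S
    rw [h0S, zero_mul] at hBirch
    exact (mul_ne_zero hτ hL') hBirch.symm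
  have hLW' : W'.entireLFunction 1 =
      ratTwistedSymbolSum f' (ZMod.χ₈.ringHomComp (Int.castRingHom ℂ)) * (plusPeriod f' : ℂ) /
        gaussSum (ZMod.χ₈.ringHomComp (Int.castRingHom ℂ)) (ZMod.stdAddChar (N := 8)) := by
    rw [eq_div_iff hτ]; linear_combination -hBirch
  -- substitute into the law and cancel `ψ(S₈(f′))·ψ(Ω⁺_{f′})`
  rw [hLW', hval, hψ, hψ] at hlaw
  rw [hψ, hψ]
  have hψS : ψ (ratTwistedSymbolSum f' (ZMod.χ₈.ringHomComp (Int.castRingHom ℂ))) ≠ 0 :=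
    (map_ne_zero ψ).mpr hS
  have hψΩ : ψ (plusPeriod f' : ℂ) ≠ 0 := (map_ne_zero ψ).mpr hΩ'
  have hψτ : ψ (gaussSum (ZMod.χ₈.ringHomComp (Int.castRingHom ℂ)) (ZMod.stdAddChar (N := 8))) ≠ 0 :=
    (map_ne_zero ψ).mpr hτ
  simp only [map_mul, map_div₀] at hlaw ⊢
  field_simp at hlaw
  field_simp
  linear_combination hlaw

end Companion

end Summit.BirchSwinnertonDyer.BirchSwinnertonDyer.Theorems.PrintCf2.DisegniPairTwo

end
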